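import Mathlib
import Summits.ValiantsHypothesis.ValiantsHypothesis.Theorems.BarrierLeverPartitionMinorsHitByVPHiddenStatesPathTableStaircase
import Summits.ValiantsHypothesis.ValiantsHypothesis.Theorems.BarrierLeverPartitionMinorsHitByVPHiddenStatesPathTableTransfer
import Summits.ValiantsHypothesis.ValiantsHypothesis.Theorems.BarrierLeverPartitionMinorsHitByVPHiddenStatesPathTablePeel
import Summits.ValiantsHypothesis.ValiantsHypothesis.Theorems.BarrierLeverPartitionMinorsHitByVPHiddenStatesPathTable

/-!
# Route BarrierLever — item `PartitionMinorsHitByVP` (stmt-ValiantsHypothesis-19717), line `hidden-states`: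
# THE PATH TABLE OF `P_k` — level-`j` staircase functionals `Gj` and their three insertion laws

Helper file (`--supports stmt-ValiantsHypothesis-19717`; cell valiant-natproofs, 𝒟-side door (c), registered line
`Cruxes/PartitionMinorsHitByVP/Lines/hidden_states.lean` v8; prover seat val-np-p6 gen 16).  Closes NO item.  Definitions `Xlt`
(X-elements of level `< j`), `Lj` (missing levels `< j`), `Gj k s j c R` (the level-`j` staircase weight of `R` with an EXTERNAL top
Y-value `c`, guarded), `Yj` (the first `j` Y-coordinates); the engine of THEOREM B of memo HOME/val-np-p6/g16/MEMO-valnp6-g16.md §3: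
for `R` an image of `Yj j`, passing to level `j+1` after inserting (α) the X-element of level `j` changes nothing (`Gj_insert_idx`),
(β) the Y-element `j` kills the term (`Gj_insert_inl_self`: the staircase cannot close, or cardinality), (γ) the Y-element `j − 1`
(the DOWN move of the path) multiplies by `−(−s)^{c−j}` and lowers the external value to `j − 1` (`Gj_insert_inl_pred`).

WHAT THIS IS NOT: no item statement; nothing on crux 14610 or VP ≠ VNP.
-/

set_option linter.dupNamespace false

namespace Summit.ValiantsHypothesis.ValiantsHypothesis.Theorems.BarrierLever.HiddenStates

open Finset

noncomputable section

namespace PathTable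

variable {k : ℕ} {s : ℂ}
/-! ## Theorem B: the value on the row `Y` -/

/-- the X-elements of level `< j`. -/
def Xlt (k j : ℕ) : Finset (Fin k) := Finset.univ.filter (fun i : Fin k => lvlX k i < j)

/-- the levels `< j` missing from `R`. -/
def Lj (k j : ℕ) (R : Finset (Fin (k + 1) ⊕ Fin k)) : Finset ℕ := (Xlt k j \ R.toRight).image (lvlX k)

/-- the level-`j` staircase functional with an external top value `c` (guarded). -/
def Gj (k : ℕ) (s : ℂ) (j c : ℕ) (R : Finset (Fin (k + 1) ⊕ Fin k)) : ℂ :=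
  if (Xlt k j \ R.toRight).card = (Lj k j R).card then zetaLA s (Lj k j R) (insert c (Aset k R)) else 0

/-- the first `j` Y-coordinates `inl 0, …, inl (j−1)`. -/
def Yj (k j : ℕ) : Finset (Fin (k + 1) ⊕ Fin k) :=
  ((Finset.univ : Finset (Fin (k + 1))).filter (fun b : Fin (k + 1) => (b : ℕ) < j)).image Sum.inl

/-- membership in `Yj`. -/
theorem mem_Yj {j : ℕ} {x : Fin (k + 1) ⊕ Fin k} : x ∈ Yj k j ↔ ∃ b : Fin (k + 1), (b : ℕ) < j ∧ Sum.inl b = x := by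
  simp [Yj]

/-- `Yj (j+1) = Yj j + inl j`. -/
theorem Yj_succ {j : ℕ} (hj : j ≤ k) :
    Yj k (j + 1) = insert (Sum.inl (⟨j, by omega⟩ : Fin (k + 1))) (Yj k j) ∧
      Sum.inl (⟨j, by omega⟩ : Fin (k + 1)) ∉ Yj k j := by
  constructor
  · ext x
    simp only [mem_Yj, Finset.mem_insert]
    constructor
    · rintro ⟨b, hb, rfl⟩
      by_cases hbj : (b : ℕ) = j
      · left; congr 1; exact Fin.ext hbj
      · right; exact ⟨b, by omega, rfl⟩
    · rintro (rfl | ⟨b, hb, rfl⟩)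
      · exact ⟨_, by simp, rfl⟩
      · exact ⟨b, by omega, rfl⟩
  · rw [mem_Yj]
    rintro ⟨b, hb, hbb⟩
    have h1 : b = ⟨j, by omega⟩ := Sum.inl_injective hbb
    have h2 : (b : ℕ) = j := congrArg Fin.val h1
    omega

/-- support of a nonzero-weight image of `Yj j`: Y-values `< j`, X-levels `< j`. -/
theorem image_Yj_support {j : ℕ} {φ : Fin (k + 1) ⊕ Fin k → Fin (k + 1) ⊕ Fin k}
    (hw : ∏ x ∈ Yj k j, pw k s x (φ x) ≠ 0) :
    (∀ b : Fin (k + 1), Sum.inl b ∈ (Yj k j).image φ → (b : ℕ) < j) ∧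
      ((Yj k j).image φ).toRight ⊆ Xlt k j := by
  constructor
  · intro b hb
    obtain ⟨x, hx, hφx⟩ := Finset.mem_image.1 hb
    have hwx : pw k s x (φ x) ≠ 0 := fun h => hw (Finset.prod_eq_zero hx h)
    obtain ⟨b', hb', rfl⟩ := mem_Yj.1 hx
    rw [hφx] at hwx
    simp only [pw] at hwx
    by_cases h1 : b = b'
    · rw [h1]; exact hb'
    · rw [if_neg h1] at hwx
      by_cases h2 : (b : ℕ) + 1 = (b' : ℕ)
      · omega
      · rw [if_neg h2] at hwx; exact (hwx rfl).elim
  · intro i hi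
    rw [Finset.mem_toRight] at hi
    obtain ⟨x, hx, hφx⟩ := Finset.mem_image.1 hi
    have hwx : pw k s x (φ x) ≠ 0 := fun h => hw (Finset.prod_eq_zero hx h)
    obtain ⟨b', hb', rfl⟩ := mem_Yj.1 hx
    rw [hφx] at hwx
    simp only [pw] at hwx
    by_cases h1 : lvlX k i = (b' : ℕ)
    · exact Finset.mem_filter.2 ⟨Finset.mem_univ _, by omega⟩
    · rw [if_neg h1] at hwx; exact (hwx rfl).elim

/-- cardinality of `Xlt j`: `j + 1` elements (`1 ≤ j ≤ k − 1`). -/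
theorem card_Xlt {j : ℕ} (hj1 : 1 ≤ j) (hjk : j + 1 ≤ k) : (Xlt k j).card = j + 1 := by
  have : Xlt k j = Finset.univ.filter (fun i : Fin k => (i : ℕ) < j + 1) := by
    ext i; simp only [Xlt, lvlX, Finset.mem_filter, Finset.mem_univ, true_and]; omega
  rw [this, Fin.card_filter_val_lt]; omega

/-- the index of the X-element of level `j ≥ 1`. -/
theorem lvlX_eq_iff_of_pos {j : ℕ} (hj : 1 ≤ j) (i : Fin k) : lvlX k i = j ↔ (i : ℕ) = j + 1 := by
  simp only [lvlX]; omega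

/-- `Xlt (j+1) = Xlt j + (the element of level j)` for `j ≥ 1`. -/
theorem Xlt_succ {j : ℕ} (hj : 1 ≤ j) (hjk : j + 1 < k) :
    Xlt k (j + 1) = insert (⟨j + 1, hjk⟩ : Fin k) (Xlt k j) ∧ (⟨j + 1, hjk⟩ : Fin k) ∉ Xlt k j := by
  constructor
  · ext i
    simp only [Xlt, Finset.mem_filter, Finset.mem_univ, true_and, Finset.mem_insert, Fin.ext_iff, lvlX]
    omega
  · simp [Xlt, lvlX]

/-- cardinality bookkeeping for `Lj`: under the guard, `|Lj j R| + |R.toRight| = j + 1` when `R.toRight ⊆ Xlt j`. -/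
theorem card_Lj {j : ℕ} (hj1 : 1 ≤ j) (hjk : j + 1 ≤ k) {R : Finset (Fin (k + 1) ⊕ Fin k)}
    (hRX : R.toRight ⊆ Xlt k j) (hg : (Xlt k j \ R.toRight).card = (Lj k j R).card) :
    (Lj k j R).card + R.toRight.card = j + 1 := by
  rw [← hg, Finset.card_sdiff_of_subset hRX, card_Xlt hj1 hjk]
  have := Finset.card_le_card hRX
  rw [card_Xlt hj1 hjk] at this
  omega

/-- `Gj` vanishes off the top cardinality. -/
theorem Gj_card_ne {j c : ℕ} (hj1 : 1 ≤ j) (hjk : j + 1 ≤ k) {R : Finset (Fin (k + 1) ⊕ Fin k)}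
    (hRX : R.toRight ⊆ Xlt k j) (hc : c ∉ Aset k R) (hR : R.card ≠ j) : Gj k s j c R = 0 := by
  unfold Gj
  split_ifs with hg
  · apply zetaLA_of_card_ne
    rw [Finset.card_insert_of_notMem hc, card_Aset]
    have h1 := card_Lj hj1 hjk hRX hg
    have h2 := Finset.card_toLeft_add_card_toRight (u := R)
    omega
  · rfl

/-- (α) inserting the X-element of level `j` and passing to level `j + 1` changes nothing. -/
theorem Gj_insert_idx {j c : ℕ} (hj : 1 ≤ j) (hjk : j + 1 < k) (R : Finset (Fin (k + 1) ⊕ Fin k)) :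
    Gj k s (j + 1) c (insert (Sum.inr (⟨j + 1, hjk⟩ : Fin k)) R) = Gj k s j c R := by
  obtain ⟨hX, hidx⟩ := Xlt_succ (k := k) hj hjk
  have hset : Xlt k (j + 1) \ (insert (Sum.inr (⟨j + 1, hjk⟩ : Fin k)) R).toRight = Xlt k j \ R.toRight := by
    rw [hX, Finset.toRight_insert_inr]
    ext i
    simp only [Finset.mem_sdiff, Finset.mem_insert]
    constructor
    · rintro ⟨h1 | h1, h2⟩
      · exact (h2 (Or.inl h1)).elim
      · exact ⟨h1, fun h => h2 (Or.inr h)⟩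
    · rintro ⟨h1, h2⟩
      exact ⟨Or.inr h1, fun h => h.elim (fun h => hidx (h ▸ h1)) h2⟩
  have hA : Aset k (insert (Sum.inr (⟨j + 1, hjk⟩ : Fin k)) R) = Aset k R := by simp [Aset]
  simp only [Gj, Lj, hset, hA]

/-- the sets at level `j + 1` after inserting a Y-element. -/
theorem Lj_succ_insert_inl {j : ℕ} (hj : 1 ≤ j) (hjk : j + 1 < k) {R : Finset (Fin (k + 1) ⊕ Fin k)}
    (hRX : R.toRight ⊆ Xlt k j) (b : Fin (k + 1)) :
    Xlt k (j + 1) \ (insert (Sum.inl b) R).toRight = insert (⟨j + 1, hjk⟩ : Fin k) (Xlt k j \ R.toRight) ∧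
      (⟨j + 1, hjk⟩ : Fin k) ∉ Xlt k j \ R.toRight ∧
      Lj k (j + 1) (insert (Sum.inl b) R) = insert j (Lj k j R) ∧ (∀ ℓ ∈ Lj k j R, ℓ < j) := by
  obtain ⟨hX, hidx⟩ := Xlt_succ (k := k) hj hjk
  have hidxR : (⟨j + 1, hjk⟩ : Fin k) ∉ R.toRight := fun h => hidx (hRX h)
  have hset : Xlt k (j + 1) \ (insert (Sum.inl b) R).toRight = insert (⟨j + 1, hjk⟩ : Fin k) (Xlt k j \ R.toRight) := by
    rw [hX, Finset.toRight_insert_inl, Finset.insert_sdiff_of_notMem _ hidxR]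
  have hnot : (⟨j + 1, hjk⟩ : Fin k) ∉ Xlt k j \ R.toRight := fun h => hidx (Finset.mem_sdiff.1 h).1
  refine ⟨hset, hnot, ?_, ?_⟩
  · unfold Lj
    rw [hset, Finset.image_insert]
    congr 1
  · intro ℓ hℓ
    obtain ⟨i, hi, rfl⟩ := Finset.mem_image.1 hℓ
    exact (Finset.mem_filter.1 (Finset.mem_sdiff.1 hi).1).2

/-- guard transfer along the insertion of the level-`j` index. -/
theorem guard_succ_iff {j : ℕ} (hj : 1 ≤ j) (hjk : j + 1 < k) {R : Finset (Fin (k + 1) ⊕ Fin k)}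
    (hRX : R.toRight ⊆ Xlt k j) (b : Fin (k + 1)) :
    (Xlt k (j + 1) \ (insert (Sum.inl b) R).toRight).card = (Lj k (j + 1) (insert (Sum.inl b) R)).card ↔
      (Xlt k j \ R.toRight).card = (Lj k j R).card := by
  obtain ⟨hset, hnot, hL, hlt⟩ := Lj_succ_insert_inl (k := k) hj hjk hRX b
  have hjL : j ∉ Lj k j R := fun h => lt_irrefl _ (hlt j h)
  rw [hset, hL, Finset.card_insert_of_notMem hnot, Finset.card_insert_of_notMem hjL]
  unfold Lj
  omega

/-- (β) inserting the Y-element `j` itself and passing to level `j + 1` kills the term. -/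
theorem Gj_insert_inl_self {j c : ℕ} (hj : 1 ≤ j) (hjk : j + 1 < k) (hc : j ≤ c)
    {R : Finset (Fin (k + 1) ⊕ Fin k)} (hRX : R.toRight ⊆ Xlt k j)
    (hRY : ∀ b : Fin (k + 1), Sum.inl b ∈ R → (b : ℕ) < j) (hRcard : R.card ≤ j) :
    Gj k s (j + 1) c (insert (Sum.inl (⟨j, by omega⟩ : Fin (k + 1))) R) = 0 := by
  obtain ⟨hset, hnot, hL, hlt⟩ := Lj_succ_insert_inl (k := k) hj hjk hRX (⟨j, by omega⟩ : Fin (k + 1))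
  unfold Gj
  split_ifs with hg
  · rw [hL]
    have hA : Aset k (insert (Sum.inl (⟨j, by omega⟩ : Fin (k + 1))) R) = insert j (Aset k R) := by
      simp [Aset, Finset.image_insert]
    rw [hA]
    have hAlt : ∀ a ∈ Aset k R, a < j := by
      intro a ha; obtain ⟨b, hb, rfl⟩ := mem_Aset.1 ha; exact hRY b hb
    have hg0 : (Xlt k j \ R.toRight).card = (Lj k j R).card :=
      (guard_succ_iff hj hjk hRX _).1 hg
    by_cases hcj : c = j
    · subst hcj
      rw [Finset.insert_eq_of_mem (Finset.mem_insert_self _ _), zetaLA_insert_top s hlt hAlt]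
      split_ifs
      · rw [zetaLA_of_card_ne, zero_mul]
        rw [card_Aset]
        have h1 := card_Lj hj (by omega) hRX hg0
        have h2 := Finset.card_toLeft_add_card_toRight (u := R)
        omega
      · rfl
    · have hA2 : ∀ a ∈ insert j (Aset k R), a < c := fun a ha => by
        rcases Finset.mem_insert.1 ha with h | h
        · omega
        · have := hAlt a h; omega
      rw [zetaLA_insert_top s hlt hA2, if_neg]
      rintro ⟨hall, -⟩
      exact lt_irrefl _ (hall j (Finset.mem_insert_self _ _))
  · rfl

/-- (γ) inserting the Y-element `j − 1` (the DOWN move) and passing to level `j + 1`. -/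
theorem Gj_insert_inl_pred {j c : ℕ} (hj : 1 ≤ j) (hjk : j + 1 < k) (hc : j ≤ c)
    {R : Finset (Fin (k + 1) ⊕ Fin k)} (hRX : R.toRight ⊆ Xlt k j)
    (hRY : ∀ b : Fin (k + 1), Sum.inl b ∈ R → (b : ℕ) < j) (hRcard : R.card ≤ j) :
    Gj k s (j + 1) c (insert (Sum.inl (⟨j - 1, by omega⟩ : Fin (k + 1))) R) =
      -((-s) ^ (c - j)) * Gj k s j (j - 1) R := by
  have hAlt : ∀ a ∈ Aset k R, a < j := by
    intro a ha; obtain ⟨b, hb, rfl⟩ := mem_Aset.1 ha; exact hRY b hb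
  by_cases hmem : Sum.inl (⟨j - 1, by omega⟩ : Fin (k + 1)) ∈ R
  · -- collapsed term: both sides vanish by cardinality
    rw [Finset.insert_eq_of_mem hmem]
    have hj1A : j - 1 ∈ Aset k R := mem_Aset.2 ⟨_, hmem, rfl⟩
    have hcA : c ∉ Aset k R := fun h => by have := hAlt c h; omega
    have hR : Gj k s j (j - 1) R = 0 := by
      unfold Gj
      split_ifs with hg
      · rw [Finset.insert_eq_of_mem hj1A]
        apply zetaLA_of_card_ne
        rw [card_Aset]
        have h1 := card_Lj hj (by omega) hRX hg
        have h2 := Finset.card_toLeft_add_card_toRight (u := R)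
        omega
      · rfl
    have hL : Gj k s (j + 1) c R = 0 := by
      unfold Gj
      split_ifs with hg
      · apply zetaLA_of_card_ne
        rw [Finset.card_insert_of_notMem hcA, card_Aset]
        -- `Lj (j+1) R = insert j (Lj j R)`
        obtain ⟨hset, hnot, hLs, hlt⟩ := Lj_succ_insert_inl (k := k) hj hjk hRX (⟨j - 1, by omega⟩ : Fin (k + 1))
        rw [Finset.insert_eq_of_mem hmem] at hset hLs
        have hjL : j ∉ Lj k j R := fun h => lt_irrefl _ (hlt j h)
        have hg0 : (Xlt k j \ R.toRight).card = (Lj k j R).card := by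
          have := (guard_succ_iff (k := k) hj hjk hRX (⟨j - 1, by omega⟩ : Fin (k + 1)))
          rw [Finset.insert_eq_of_mem hmem] at this
          exact this.1 hg
        rw [hLs, Finset.card_insert_of_notMem hjL]
        have h1 := card_Lj hj (by omega) hRX hg0
        have h2 := Finset.card_toLeft_add_card_toRight (u := R)
        omega
      · rfl
    rw [hL, hR, mul_zero]
  · obtain ⟨hset, hnot, hLs, hlt⟩ := Lj_succ_insert_inl (k := k) hj hjk hRX (⟨j - 1, by omega⟩ : Fin (k + 1))
    have hA : Aset k (insert (Sum.inl (⟨j - 1, by omega⟩ : Fin (k + 1))) R) = insert (j - 1) (Aset k R) := by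
      simp [Aset, Finset.image_insert]
    have hguard := guard_succ_iff (k := k) hj hjk hRX (⟨j - 1, by omega⟩ : Fin (k + 1))
    unfold Gj
    by_cases hg : (Xlt k j \ R.toRight).card = (Lj k j R).card
    · rw [if_pos (hguard.2 hg), if_pos hg, hLs, hA]
      have hA2 : ∀ a ∈ insert (j - 1) (Aset k R), a < c := fun a ha => by
        rcases Finset.mem_insert.1 ha with h | h
        · omega
        · have := hAlt a h; omega
      rw [zetaLA_insert_top s hlt hA2, if_pos]
      · ring
      · refine ⟨fun a ha => ?_, hc⟩
        rcases Finset.mem_insert.1 ha with h | h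
        · omega
        · exact hAlt a h
    · rw [if_neg (fun h => hg (hguard.1 h)), if_neg hg, mul_zero]

end PathTable

end

end Summit.ValiantsHypothesis.ValiantsHypothesis.Theorems.BarrierLever.HiddenStates
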